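import Summits.BirchSwinnertonDyer.Rank1Residual.Additive.X3BranchGordEndStateThreeOfLiftingFact
import Summits.BirchSwinnertonDyer.Rank1Residual.Additive.X3ThreeLineDatum
import Summits.BirchSwinnertonDyer.Rank1Residual.Additive.N10IsogenyTransport
import HarnessLib

/-!
# X3♯(G-ord, `e = 2`) at `p = 3`: the end state consuming the ONE-predicate line datum
# `X3LineDatumThree W` (per-pair records `X3ThreeLineDatumRecords*.lean`), and the Cassels transport to
# the other members of the isogeny class — the BY-NAME sentences of the B-X3G booking at `p = 3`
# (cell `bsd-addord`, seat `bsd-addord-twist`, strategy = twist transport)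

HONEST FRAMING (cell `bsd-addord`, `run/shared/lean/pub/bsd-addord/README.md` §4): the programme's
target of record is the full Birch–Swinnerton-Dyer formula for every `E/ℚ` of analytic rank `≤ 1`;
this file concerns the non-degenerate X3 rows of cell (G-ord, `e = 2`) at `p = 3`, `r_an = 0`, non-CM,
non-anomalous. THEOREMS ONLY (no `def`, no named fact, no `sorry`); nothing is booked by this file
(planner's act, TARGET.md v5.5 §8 protocol B-X3G). Every hypothesis that is not a class binder, the
line-datum predicate or an isogeny is a PUBLISHED named fact of the tree.

## What

* `ClassX3Gord.missingLowerBoundAt_three_rankZero_of_facts_of_lineDatum_of_nonAnomalous` /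
  `ClassX3Gord.bsdp_three_rankZero_of_facts_of_lineDatum_of_nonAnomalous` — the `p = 3` end states of
  `X3BranchGordEndStateThreeOfLiftingFact.lean` with the four line binders packaged as
  `X3LineDatumThree W` (so that a per-pair record `x3LineDatumThree_<label>` is the ONLY per-pair
  input): PUBLISHED facts `hW16 hGV h23 h414 hGrK hLiftE hDel3 [hDel98] hGZK hmod hmodD` → class
  binders `ClassX3Gord W 3`, `¬ HasCM`, `analyticRank = 0`, `ReductionNonAnomalous W 3` →
  `X3LineDatumThree W` → `MissingLowerBoundAt W 3` / `BSDp W 3`.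
* `ClassX3Gord.bsdp_three_of_isIsogenous_of_facts_of_lineDatum_of_nonAnomalous` — for ANOTHER member
  `W` of the class: `BSDp W 3` from the Case-1 member `W'` (its class binders + record) by Cassels
  (`N10.bsdp_of_isIsogenous_of_bsdp`, binder `hCassels : bsdRHS_eq_of_isIsogenous`), and
  `…missingLowerBoundAt_three_of_isIsogenous…` likewise.

References: [GreenbergVatsal2000] §2 (11), (16), pp. 28–30, §3 Thm. (3.12); [Wuthrich2014] Thm. 16;
[Delbourgo2002] Thm. (A), (B); [Delbourgo1998] Prop. 4; [MilneADT2006] Thm. I.7.3 (Cassels);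
[Miller2011LMS] Def. 1.1.
-/

set_option autoImplicit false

noncomputable section

open scoped Classical

namespace Summit.BirchSwinnertonDyer.Rank1Residual.Additive

open WeierstrassCurve NumberField IsDedekindDomain Field
  Literature.NumberTheory.EllipticCurves
  Literature.NumberTheory.EllipticCurves.ModularForms
  Literature.NumberTheory.EllipticCurves.GreenbergVatsal2000
  Literature.NumberTheory.EllipticCurves.Rank1Residual
  Literature.NumberTheory.EllipticCurves.Rank1Residual.Typed
  Summit.BirchSwinnertonDyer.Rank1Residual.AdditivePotMult
  Summit.BirchSwinnertonDyer.Rank1Residual.Additive.X3Branch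

variable {W : WeierstrassCurve ℚ} [W.IsElliptic] [W.IsGloballyMinimal]

/-- **`p = 3` end state, lower half, with the line datum as ONE predicate.** PUBLISHED facts + class
binders + `X3LineDatumThree W` ⟹ `Typed.MissingLowerBoundAt W 3`.
[cite: Delbourgo2002, Theorem (A), (B) (p. 40)] [cite: GreenbergVatsal2000, §2 (11), (16), pp. 28–30, §3 Thm. (3.12) p. 45]
[cite: Wuthrich2014, Thm. 16 (p. 397)] [cite: Miller2011LMS, Def. 1.1] -/
theorem ClassX3Gord.missingLowerBoundAt_three_rankZero_of_facts_of_lineDatum_of_nonAnomalous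
    [Fact (Nat.Prime 3)]
    (hW16 : Wuthrich2014.thm16_halfEigenCharIdeal_dvd_cyclotomicPrime)
    (hGV : thm312_branch_unitContent_and_lambda_eq_residual_goodOrd)
    (h23 : datumSelmer_nonPrimitive_invariants)
    (h414 : Greenberg1999.prop414_noFiniteSubmodule_of_not_dvd_torsionOrder)
    (hGrK : Greenberg1999.imKummer_ge_strictCondition_goodOrdinary)
    (hLiftE : residualEpsilon_surjOn_of_lineEven)
    (hDel3 : Delbourgo2002.mainTheorem_three)
    (hGZK : rank_eq_analyticRank_of_analyticRank_le_one) (hmod : hasEntireLFunction_rat)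
    (hmodD : nonempty_modularParametrizationData)
    (hX : ClassX3Gord W 3) (hcm : ¬ W.HasCM) (hr : W.analyticRank = 0)
    (hna : Delbourgo2002.ReductionNonAnomalous W 3) (hL : X3LineDatumThree W) :
    MissingLowerBoundAt W 3 := by
  obtain ⟨Φ₀, hΦ, heven, hnt, hram⟩ := hL
  exact ClassX3Gord.missingLowerBoundAt_three_rankZero_of_facts_of_nonAnomalous hW16 hGV h23 h414 hGrK
    hLiftE hDel3 hGZK hmod hmodD hX hcm hr hna Φ₀ hΦ heven hnt hram

/-- **`p = 3` end state, `BSD(E,3)`, with the line datum as ONE predicate.** PUBLISHED facts + class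
binders + `X3LineDatumThree W` ⟹ `BSDp W 3`.
[cite: Delbourgo2002, Theorem (A), (B) (p. 40)] [cite: Delbourgo1998, Prop. 4 (p. 144)]
[cite: Wuthrich2014, Thm. 16 (p. 397)] [cite: GreenbergVatsal2000, §2 (11), (16), pp. 28–30]
[cite: Miller2011LMS, §1 and Def. 1.1] -/
theorem ClassX3Gord.bsdp_three_rankZero_of_facts_of_lineDatum_of_nonAnomalous
    [Fact (Nat.Prime 3)]
    (hW16 : Wuthrich2014.thm16_halfEigenCharIdeal_dvd_cyclotomicPrime)
    (hGV : thm312_branch_unitContent_and_lambda_eq_residual_goodOrd)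
    (h23 : datumSelmer_nonPrimitive_invariants)
    (h414 : Greenberg1999.prop414_noFiniteSubmodule_of_not_dvd_torsionOrder)
    (hGrK : Greenberg1999.imKummer_ge_strictCondition_goodOrdinary)
    (hLiftE : residualEpsilon_surjOn_of_lineEven)
    (hDel3 : Delbourgo2002.mainTheorem_three)
    (hDel98 : Delbourgo1998.prop4_rankZero_pow_dvd_constantCoeff)
    (hGZK : rank_eq_analyticRank_of_analyticRank_le_one) (hmod : hasEntireLFunction_rat)
    (hmodD : nonempty_modularParametrizationData)
    (hX : ClassX3Gord W 3) (hcm : ¬ W.HasCM) (hr : W.analyticRank = 0)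
    (hna : Delbourgo2002.ReductionNonAnomalous W 3) (hL : X3LineDatumThree W) :
    BSDp W 3 := by
  obtain ⟨Φ₀, hΦ, heven, hnt, hram⟩ := hL
  exact ClassX3Gord.bsdp_three_rankZero_of_facts_of_nonAnomalous hW16 hGV h23 h414 hGrK hLiftE hDel3
    hDel98 hGZK hmod hmodD hX hcm hr hna Φ₀ hΦ heven hnt hram

/-! ### The other members of the isogeny class (Cassels) -/

variable {W' : WeierstrassCurve ℚ} [W'.IsElliptic] [W'.IsGloballyMinimal]

/-- **`BSD(E,3)` for ANY member `W` of the class of a Case-1 member `W'`** (`W'` carries the class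
binders and the record `X3LineDatumThree W'`): Cassels' isogeny invariance of the BSD quotient
(`hCassels`, through `N10.bsdp_of_isIsogenous_of_bsdp`). [cite: MilneADT2006, Thm. I.7.3 and Remark I.7.4]
[cite: Miller2011LMS, §1] -/
theorem ClassX3Gord.bsdp_three_of_isIsogenous_of_facts_of_lineDatum_of_nonAnomalous
    [Fact (Nat.Prime 3)]
    (hCassels : bsdRHS_eq_of_isIsogenous)
    (hW16 : Wuthrich2014.thm16_halfEigenCharIdeal_dvd_cyclotomicPrime)
    (hGV : thm312_branch_unitContent_and_lambda_eq_residual_goodOrd)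
    (h23 : datumSelmer_nonPrimitive_invariants)
    (h414 : Greenberg1999.prop414_noFiniteSubmodule_of_not_dvd_torsionOrder)
    (hGrK : Greenberg1999.imKummer_ge_strictCondition_goodOrdinary)
    (hLiftE : residualEpsilon_surjOn_of_lineEven)
    (hDel3 : Delbourgo2002.mainTheorem_three)
    (hDel98 : Delbourgo1998.prop4_rankZero_pow_dvd_constantCoeff)
    (hGZK : rank_eq_analyticRank_of_analyticRank_le_one) (hmod : hasEntireLFunction_rat)
    (hmodD : nonempty_modularParametrizationData)
    (hiso : IsIsogenous W W')
    (hX' : ClassX3Gord W' 3) (hcm' : ¬ W'.HasCM) (hr' : W'.analyticRank = 0)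
    (hna' : Delbourgo2002.ReductionNonAnomalous W' 3) (hL' : X3LineDatumThree W') :
    BSDp W 3 := by
  have hr : W.analyticRank ≤ 1 := by
    rw [analyticRank_eq_of_isIsogenous' hiso, hr']
    exact zero_le_one
  exact N10.bsdp_of_isIsogenous_of_bsdp 3 hCassels hGZK hmod hiso hr
    (ClassX3Gord.bsdp_three_rankZero_of_facts_of_lineDatum_of_nonAnomalous hW16 hGV h23 h414 hGrK hLiftE
      hDel3 hDel98 hGZK hmod hmodD hX' hcm' hr' hna' hL')

/-- **The lower half for ANY member `W` of the class of a Case-1 member `W'`** (from `BSD(W,3)`;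
`N10.missingLowerBoundAt_of_isIsogenous_of_bsdp`). [cite: MilneADT2006, Thm. I.7.3] [cite: Miller2011LMS, Def. 1.1] -/
theorem ClassX3Gord.missingLowerBoundAt_three_of_isIsogenous_of_facts_of_lineDatum_of_nonAnomalous
    [Fact (Nat.Prime 3)]
    (hCassels : bsdRHS_eq_of_isIsogenous)
    (hW16 : Wuthrich2014.thm16_halfEigenCharIdeal_dvd_cyclotomicPrime)
    (hGV : thm312_branch_unitContent_and_lambda_eq_residual_goodOrd)
    (h23 : datumSelmer_nonPrimitive_invariants)
    (h414 : Greenberg1999.prop414_noFiniteSubmodule_of_not_dvd_torsionOrder)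
    (hGrK : Greenberg1999.imKummer_ge_strictCondition_goodOrdinary)
    (hLiftE : residualEpsilon_surjOn_of_lineEven)
    (hDel3 : Delbourgo2002.mainTheorem_three)
    (hDel98 : Delbourgo1998.prop4_rankZero_pow_dvd_constantCoeff)
    (hGZK : rank_eq_analyticRank_of_analyticRank_le_one) (hmod : hasEntireLFunction_rat)
    (hmodD : nonempty_modularParametrizationData)
    (hiso : IsIsogenous W W')
    (hX' : ClassX3Gord W' 3) (hcm' : ¬ W'.HasCM) (hr' : W'.analyticRank = 0)
    (hna' : Delbourgo2002.ReductionNonAnomalous W' 3) (hL' : X3LineDatumThree W') :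
    MissingLowerBoundAt W 3 := by
  have hr : W.analyticRank ≤ 1 := by
    rw [analyticRank_eq_of_isIsogenous' hiso, hr']
    exact zero_le_one
  exact N10.missingLowerBoundAt_of_isIsogenous_of_bsdp 3 hCassels hGZK hmod hiso hr
    (ClassX3Gord.bsdp_three_rankZero_of_facts_of_lineDatum_of_nonAnomalous hW16 hGV h23 h414 hGrK hLiftE
      hDel3 hDel98 hGZK hmod hmodD hX' hcm' hr' hna' hL')

end Summit.BirchSwinnertonDyer.Rank1Residual.Additive

end
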